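import Summits.ValiantsHypothesis.ValiantsHypothesis.Theorems.BarrierLeverChowCubeThetaHatPeel

/-!
# Route BarrierLever — items 20195 / 20172: the PEELING CALCULUS for `det Θ̂ ≠ 0`, II:
# the peeling steps (P1), (P2), (P3)

Helper file (`--supports stmt-ValiantsHypothesis-20195`; cell valiant-natproofs, rung V4, 𝒟-side of
door (c); seat val-np-p2 gen 8).  Closes NO item; definition-free.  Continues `…ChowCubeThetaHatPeel`
(generic table `q a c = X (a, c)` over `R₀ = MvPolynomial (Fin h × Fin h) ℂ`; `Θ` below is any
function satisfying `Θ U S = coeff (E ∅ S) ∏_{a ∈ U} t_a(X)`, i.e. `Θ = Θ̂_X`).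

PEELING A COORDINATE `c`: apply the substitution `σ_c : X (a, c) ↦ 0 (a ≠ c), X (c, c') ↦ 0 (c' ≠ c)`
to `det Θ̂[u, δ]`.  After a column permutation `π` matching the rows through `c` with the columns
through `c` (`c ∈ δ (π i) ↔ c ∈ u i`), the specialised matrix is two-block triangular
(`Matrix.twoBlockTriangular_det`) with blocks `-X(c,c) · Θ̂[(u i - c), (δ (π i) - c)]_{c ∈ u i}` and
`Θ̂[u i, δ (π i)]_{c ∉ u i}` — both again `Θ̂_X`-matrices of smaller layouts.  Hence:

* **(P1) `det_thetaHat_ne_zero_of_peel`**: given `π` with `c ∈ δ (π i) ↔ c ∈ u i`, if the restricted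
  layout `(u i, δ (π i))_{c ∉ u i}` and the erased layout `(u i - c, δ (π i) - c)_{c ∈ u i}` have
  `det Θ̂ ≠ 0`, so does `(u, δ)`.  (The erased layout has rows of size `≤ 1` when the rows are thin,
  so rule (V) of the previous file discharges it.)
* **(P2) `det_thetaHat_ne_zero_of_peel_free`**: if NO column contains `c`, then `det Θ̂[u, δ] ≠ 0`
  follows from `det Θ̂[(u i - c)_i, δ] ≠ 0`.
* **(P3) `det_thetaHat_ne_zero_of_peel_cross`**: if the columns are closed under removing `c` and
  `π` matches the rows AVOIDING `c` with the columns containing `c` (`c ∈ δ (π i) ↔ c ∉ u i`), then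
  `det Θ̂[(u i)_{c∉u i}, (δ (π i) - c)] ≠ 0` and `det Θ̂[(u i - c)_{c ∈ u i}, (δ (π i))] ≠ 0` give
  `det Θ̂[u, δ] ≠ 0` (one unipotent column operation `col_{T} += X(c,c) · col_{T - c}` first).
Seat census (`num/grclass2.py`, exact): rules (V), (P1)–(P3) certify 22 805 of the 29 792 x-private-
alive (thin rows × down-closed columns) pairs at `h = 4`, and — through the cube reduction with a free
compression order — 96 % / 97 % of random thin layouts of item 20195 at `h = 4 / 5`, including every
sampled layout of the dense regime `r = 1 + h + C(h,2)`.
Together with the cube door (`…ChowCubeReductionDoor`, chain form in the next file) these rules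
certify layouts of item 20195 by an explicit x-private + cube design; e.g. the full thin row family
against any column family whose compression is `{∅} ∪ singletons ∪ pairs`, for every `h`.

WHAT THIS IS NOT: a certificate calculus; items 20195 / 20172 / 19717 stay open; nothing on crux
stmt-ValiantsHypothesis-14610 or on `VP` versus `VNP`.
-/

set_option linter.dupNamespace false

namespace Summit.ValiantsHypothesis.ValiantsHypothesis.Theorems.BarrierLever.ChowCube

open Finset MvPolynomial

variable {h : ℕ}

/-! ## 1. The coordinate specialisation `σ_c` -/

/-- The specialised table `q' = σ_c ∘ X`: `q' a c' = 0` on row `c` and column `c` off the diagonal,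
`q' a c' = X (a, c')` otherwise. -/
theorem peelHom_X (c a c' : Fin h) :
    (MvPolynomial.aeval (R := ℂ) (fun p : Fin h × Fin h =>
        if (p.2 = c ∧ p.1 ≠ c) ∨ (p.1 = c ∧ p.2 ≠ c) then (0 : MvPolynomial (Fin h × Fin h) ℂ)
        else X p)).toRingHom (X (a, c')) =
      if (c' = c ∧ a ≠ c) ∨ (a = c ∧ c' ≠ c) then 0 else X (a, c') := by
  rw [AlgHom.toRingHom_eq_coe, RingHom.coe_coe, aeval_X]

/-! ## 2. The peeled table `Θ' = σ_c Θ` -/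

/-- **The peeled entries.**  For `Θ = Θ̂_X` and a coordinate `c` there are a ring endomorphism
`σ` of `R₀` (the specialisation `σ_c`) and a function `Θ'` with `σ (Θ U S) = Θ' U S` such that:
`Θ' U S = Θ U S` if neither `U` nor `S` contains `c`; `Θ' U S = -X(c,c) · Θ (U - c) (S - c)` if both
do; `Θ' U S = 0` if only `S` does; `Θ' U S = Θ (U - c) S` if only `U` does. -/
theorem exists_peel_table
    (Θ : Finset (Fin h) → Finset (Fin h) → MvPolynomial (Fin h × Fin h) ℂ)
    (hΘ : ∀ U S, Θ U S = coeff (∑ a ∈ (∅ : Finset (Fin h)), Finsupp.single (Fin.castAdd h a) 1 +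
        ∑ c ∈ S, Finsupp.single (Fin.natAdd h c) 1)
      (∏ a ∈ U, ∑ S' ∈ (Finset.univ : Finset (Fin h)).powerset,
        monomial (∑ a' ∈ (∅ : Finset (Fin h)), Finsupp.single (Fin.castAdd h a') 1 +
          ∑ c ∈ S', Finsupp.single (Fin.natAdd h c) 1)
          ((-1 : MvPolynomial (Fin h × Fin h) ℂ) ^ S'.card *
            (S'.card.factorial : MvPolynomial (Fin h × Fin h) ℂ) * ∏ c ∈ S', X (a, c)) :
            MvPolynomial (Fin (h + h)) (MvPolynomial (Fin h × Fin h) ℂ))) (c : Fin h) :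
    ∃ (σ : MvPolynomial (Fin h × Fin h) ℂ →+* MvPolynomial (Fin h × Fin h) ℂ)
      (Θ' : Finset (Fin h) → Finset (Fin h) → MvPolynomial (Fin h × Fin h) ℂ),
      (∀ U S, σ (Θ U S) = Θ' U S) ∧
      (∀ U S, c ∉ U → c ∉ S → Θ' U S = Θ U S) ∧
      (∀ U S, c ∈ U → c ∈ S → Θ' U S = -X (c, c) * Θ (U.erase c) (S.erase c)) ∧
      (∀ U S, c ∉ U → c ∈ S → Θ' U S = 0) ∧
      (∀ U S, c ∈ U → c ∉ S → Θ' U S = Θ (U.erase c) S) := by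
  classical
  set f : MvPolynomial (Fin h × Fin h) ℂ →+* MvPolynomial (Fin h × Fin h) ℂ :=
    (MvPolynomial.aeval (R := ℂ) (fun p : Fin h × Fin h =>
      if (p.2 = c ∧ p.1 ≠ c) ∨ (p.1 = c ∧ p.2 ≠ c) then (0 : MvPolynomial (Fin h × Fin h) ℂ)
      else X p)).toRingHom with hf
  set q' : Fin h → Fin h → MvPolynomial (Fin h × Fin h) ℂ := fun a c' =>
    if (c' = c ∧ a ≠ c) ∨ (a = c ∧ c' ≠ c) then 0 else X (a, c') with hq'
  have hq'app : ∀ a c', q' a c' = if (c' = c ∧ a ≠ c) ∨ (a = c ∧ c' ≠ c) then 0 else X (a, c') :=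
    fun _ _ => rfl
  have hfX : ∀ a c', f (X (a, c')) = q' a c' := fun a c' => by rw [hq'app, hf, peelHom_X]
  have hq'col : ∀ a, a ≠ c → q' a c = 0 := fun a ha => by rw [hq'app]; simp [ha]
  have hq'row : ∀ c', c' ≠ c → q' c c' = 0 := fun c' hc' => by rw [hq'app]; simp [hc']
  have hq'gen : ∀ a c', a ≠ c → c' ≠ c → q' a c' = X (a, c') := fun a c' ha hc' => by
    rw [hq'app]; simp [ha, hc']
  have hq'cc : q' c c = X (c, c) := by rw [hq'app]; simp
  set Θ' : Finset (Fin h) → Finset (Fin h) → MvPolynomial (Fin h × Fin h) ℂ := fun U S =>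
    coeff (∑ a ∈ (∅ : Finset (Fin h)), Finsupp.single (Fin.castAdd h a) 1 +
        ∑ c ∈ S, Finsupp.single (Fin.natAdd h c) 1)
      (∏ a ∈ U, ∑ S' ∈ (Finset.univ : Finset (Fin h)).powerset,
        monomial (∑ a' ∈ (∅ : Finset (Fin h)), Finsupp.single (Fin.castAdd h a') 1 +
          ∑ c ∈ S', Finsupp.single (Fin.natAdd h c) 1)
          ((-1 : MvPolynomial (Fin h × Fin h) ℂ) ^ S'.card *
            (S'.card.factorial : MvPolynomial (Fin h × Fin h) ℂ) * ∏ c ∈ S', q' a c) :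
            MvPolynomial (Fin (h + h)) (MvPolynomial (Fin h × Fin h) ℂ)) with hΘ'
  have hΘ'app : ∀ U S, Θ' U S = coeff (∑ a ∈ (∅ : Finset (Fin h)), Finsupp.single (Fin.castAdd h a) 1 +
        ∑ c ∈ S, Finsupp.single (Fin.natAdd h c) 1)
      (∏ a ∈ U, ∑ S' ∈ (Finset.univ : Finset (Fin h)).powerset,
        monomial (∑ a' ∈ (∅ : Finset (Fin h)), Finsupp.single (Fin.castAdd h a') 1 +
          ∑ c ∈ S', Finsupp.single (Fin.natAdd h c) 1)
          ((-1 : MvPolynomial (Fin h × Fin h) ℂ) ^ S'.card *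
            (S'.card.factorial : MvPolynomial (Fin h × Fin h) ℂ) * ∏ c ∈ S', q' a c) :
            MvPolynomial (Fin (h + h)) (MvPolynomial (Fin h × Fin h) ℂ)) := fun _ _ => rfl
  have hΘ'Θ : ∀ U S, (∀ a ∈ U, a ≠ c) → (∀ c' ∈ S, c' ≠ c) → Θ' U S = Θ U S := by
    intro U S hU hS
    rw [hΘ'app, hΘ]
    exact thetaHat_congr q' (fun a c' => X (a, c')) U S fun a ha c' hc' => hq'gen a c' (hU a ha) (hS c' hc')
  refine ⟨f, Θ', fun U S => ?_, fun U S hU hS => ?_, fun U S hU hS => ?_, fun U S hU hS => ?_,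
    fun U S hU hS => ?_⟩
  · rw [hΘ, map_thetaHat, hΘ'app]
    simp_rw [hfX]
  · exact hΘ'Θ U S (fun a ha e => hU (e ▸ ha)) (fun c' hc' e => hS (e ▸ hc'))
  · rw [hΘ'app, thetaHat_row_mem q' c U S hU (fun a _ ha => hq'col a ha) hq'row, if_pos hS, hq'cc,
      ← hΘ'app, hΘ'Θ _ _ (fun a ha => Finset.ne_of_mem_erase ha) (fun c' hc' => Finset.ne_of_mem_erase hc')]
  · rw [hΘ'app]
    exact thetaHat_eq_zero_of_col q' c U S (fun a ha => hq'col a (fun e => hU (e ▸ ha))) hS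
  · rw [hΘ'app, thetaHat_row_mem q' c U S hU (fun a _ ha => hq'col a ha) hq'row, if_neg hS, ← hΘ'app,
      hΘ'Θ _ _ (fun a ha => Finset.ne_of_mem_erase ha) (fun c' hc' e => hS (e ▸ hc'))]

/-! ## 3. Rule (P1): balanced peeling -/

/-- **Rule (P1) — peeling a balanced coordinate.**  Let `Θ = Θ̂_X` (generic table), `u, δ : ι → …`
rows and columns, `c` a coordinate and `π` a permutation of `ι` with `c ∈ δ (π i) ↔ c ∈ u i`.
If the restricted layout `(u i, δ (π i))_{c ∉ u i}` and the erased layout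
`(u i - c, δ (π i) - c)_{c ∈ u i}` both have `det Θ ≠ 0`, then `det Θ[u, δ] ≠ 0`. -/
theorem det_thetaHat_ne_zero_of_peel {ι : Type*} [Fintype ι] [DecidableEq ι]
    (Θ : Finset (Fin h) → Finset (Fin h) → MvPolynomial (Fin h × Fin h) ℂ)
    (hΘ : ∀ U S, Θ U S = coeff (∑ a ∈ (∅ : Finset (Fin h)), Finsupp.single (Fin.castAdd h a) 1 +
        ∑ c ∈ S, Finsupp.single (Fin.natAdd h c) 1)
      (∏ a ∈ U, ∑ S' ∈ (Finset.univ : Finset (Fin h)).powerset,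
        monomial (∑ a' ∈ (∅ : Finset (Fin h)), Finsupp.single (Fin.castAdd h a') 1 +
          ∑ c ∈ S', Finsupp.single (Fin.natAdd h c) 1)
          ((-1 : MvPolynomial (Fin h × Fin h) ℂ) ^ S'.card *
            (S'.card.factorial : MvPolynomial (Fin h × Fin h) ℂ) * ∏ c ∈ S', X (a, c)) :
            MvPolynomial (Fin (h + h)) (MvPolynomial (Fin h × Fin h) ℂ)))
    (u δ : ι → Finset (Fin h)) (c : Fin h) (π : Equiv.Perm ι) (hπ : ∀ i, c ∈ δ (π i) ↔ c ∈ u i)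
    (h₀ : (Matrix.of fun i i' : {i // c ∉ u i} => Θ (u i) (δ (π i'))).det ≠ 0)
    (h₁ : (Matrix.of fun i i' : {i // c ∈ u i} => Θ ((u i).erase c) ((δ (π i')).erase c)).det ≠ 0) :
    (Matrix.of fun i j => Θ (u i) (δ j)).det ≠ 0 := by
  classical
  obtain ⟨f, Θ', hfΘ, hfree, hboth, hzero, -⟩ := exists_peel_table Θ hΘ c
  set N : Matrix ι ι (MvPolynomial (Fin h × Fin h) ℂ) :=
    (Matrix.of fun i j => Θ' (u i) (δ j)).submatrix id π with hN
  have hNapp : ∀ i i', N i i' = Θ' (u i) (δ (π i')) := fun i i' => by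
    rw [hN, Matrix.submatrix_apply, Matrix.of_apply, id_eq]
  have hNzero : ∀ i, ¬ (c ∈ u i) → ∀ i', c ∈ u i' → N i i' = 0 := fun i hi i' hi' => by
    rw [hNapp, hzero _ _ hi ((hπ i').mpr hi')]
  have hN₁ : N.toSquareBlockProp (fun i => c ∈ u i) = Matrix.of fun i i' : {i // c ∈ u i} =>
      (fun (_ : {i // c ∈ u i}) => -X (c, c)) i' * Θ ((u i).erase c) ((δ (π i')).erase c) := by
    ext i i'
    rw [Matrix.toSquareBlockProp_def, Matrix.of_apply, Matrix.of_apply, hNapp,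
      hboth _ _ i.2 ((hπ i').mpr i'.2)]
  have hN₀ : N.toSquareBlockProp (fun i => ¬ (c ∈ u i)) =
      Matrix.of fun i i' : {i // c ∉ u i} => Θ (u i) (δ (π i')) := by
    ext i i'
    have hi' : c ∉ δ (π (i' : ι)) := fun hh => (i'.2 : c ∉ u (i' : ι)) ((hπ i').mp hh)
    rw [Matrix.toSquareBlockProp_def, Matrix.of_apply, Matrix.of_apply, hNapp, hfree _ _ i.2 hi']
  -- determinants
  intro hdet
  have h1 : (Matrix.of fun i j => Θ' (u i) (δ j)).det = 0 := by
    have e := congr_arg f hdet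
    rw [map_zero, RingHom.map_det] at e
    rw [← e]
    congr 1
    ext i j
    rw [RingHom.mapMatrix_apply, Matrix.map_apply, Matrix.of_apply, Matrix.of_apply, hfΘ]
  have h2 : N.det = 0 := by
    rw [hN, Matrix.det_permute', h1, mul_zero]
  rw [Matrix.twoBlockTriangular_det N (fun i => c ∈ u i) hNzero, hN₁, hN₀, Matrix.det_mul_row,
    Finset.prod_const] at h2
  rcases mul_eq_zero.mp h2 with h2 | h2
  · rcases mul_eq_zero.mp h2 with h2 | h2
    · exact (neg_ne_zero.mpr (X_ne_zero (R := ℂ) (c, c))) (pow_eq_zero_iff'.mp h2).1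
    · exact h₁ h2
  · exact h₀ h2

/-! ## 4. Rule (P2): a coordinate in no column -/

/-- **Rule (P2) — peeling a coordinate that occurs in no column.**  If `c ∉ δ j` for all `j`, then
`det Θ[(u i - c)_i, δ] ≠ 0` implies `det Θ[u, δ] ≠ 0` (so in particular `i ↦ u i - c` is injective). -/
theorem det_thetaHat_ne_zero_of_peel_free {ι : Type*} [Fintype ι] [DecidableEq ι]
    (Θ : Finset (Fin h) → Finset (Fin h) → MvPolynomial (Fin h × Fin h) ℂ)
    (hΘ : ∀ U S, Θ U S = coeff (∑ a ∈ (∅ : Finset (Fin h)), Finsupp.single (Fin.castAdd h a) 1 +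
        ∑ c ∈ S, Finsupp.single (Fin.natAdd h c) 1)
      (∏ a ∈ U, ∑ S' ∈ (Finset.univ : Finset (Fin h)).powerset,
        monomial (∑ a' ∈ (∅ : Finset (Fin h)), Finsupp.single (Fin.castAdd h a') 1 +
          ∑ c ∈ S', Finsupp.single (Fin.natAdd h c) 1)
          ((-1 : MvPolynomial (Fin h × Fin h) ℂ) ^ S'.card *
            (S'.card.factorial : MvPolynomial (Fin h × Fin h) ℂ) * ∏ c ∈ S', X (a, c)) :
            MvPolynomial (Fin (h + h)) (MvPolynomial (Fin h × Fin h) ℂ)))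
    (u δ : ι → Finset (Fin h)) (c : Fin h) (hδc : ∀ j, c ∉ δ j)
    (h₀ : (Matrix.of fun i j => Θ ((u i).erase c) (δ j)).det ≠ 0) :
    (Matrix.of fun i j => Θ (u i) (δ j)).det ≠ 0 := by
  classical
  obtain ⟨f, Θ', hfΘ, hfree, -, -, hrow⟩ := exists_peel_table Θ hΘ c
  have hentry : ∀ i j, Θ' (u i) (δ j) = Θ ((u i).erase c) (δ j) := by
    intro i j
    by_cases hi : c ∈ u i
    · exact hrow _ _ hi (hδc j)
    · rw [hfree _ _ hi (hδc j), Finset.erase_eq_of_notMem hi]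
  intro hdet
  apply h₀
  have e := congr_arg f hdet
  rw [map_zero, RingHom.map_det] at e
  rw [← e]
  congr 1
  ext i j
  rw [RingHom.mapMatrix_apply, Matrix.map_apply, Matrix.of_apply, Matrix.of_apply, hfΘ, hentry]

/-! ## 5. Rule (P3): cross peeling -/

/-- **Rule (P3) — cross peeling.**  Let `c` be a coordinate such that the columns are closed under
removing `c` (`δ j - c` is a column whenever `c ∈ δ j`), and let `π` be a permutation of `ι` with
`c ∈ δ (π i) ↔ c ∉ u i` (rows avoiding `c` are as many as columns containing `c`).  If
`det Θ[(u i)_{c ∉ u i}, (δ (π i) - c)_{c ∉ u i}] ≠ 0` and `det Θ[(u i - c)_{c ∈ u i}, (δ (π i))_{c ∈ u i}] ≠ 0`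
then `det Θ[u, δ] ≠ 0`.  (After the specialisation, add `X(c,c)` times column `δ j - c` to column
`δ j` for every column through `c`; the result is two-block triangular.) -/
theorem det_thetaHat_ne_zero_of_peel_cross {ι : Type*} [Fintype ι] [DecidableEq ι]
    (Θ : Finset (Fin h) → Finset (Fin h) → MvPolynomial (Fin h × Fin h) ℂ)
    (hΘ : ∀ U S, Θ U S = coeff (∑ a ∈ (∅ : Finset (Fin h)), Finsupp.single (Fin.castAdd h a) 1 +
        ∑ c ∈ S, Finsupp.single (Fin.natAdd h c) 1)
      (∏ a ∈ U, ∑ S' ∈ (Finset.univ : Finset (Fin h)).powerset,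
        monomial (∑ a' ∈ (∅ : Finset (Fin h)), Finsupp.single (Fin.castAdd h a') 1 +
          ∑ c ∈ S', Finsupp.single (Fin.natAdd h c) 1)
          ((-1 : MvPolynomial (Fin h × Fin h) ℂ) ^ S'.card *
            (S'.card.factorial : MvPolynomial (Fin h × Fin h) ℂ) * ∏ c ∈ S', X (a, c)) :
            MvPolynomial (Fin (h + h)) (MvPolynomial (Fin h × Fin h) ℂ)))
    (u δ : ι → Finset (Fin h)) (hδ : Function.Injective δ) (c : Fin h)
    (hδcl : ∀ j, c ∈ δ j → ∃ j', δ j' = (δ j).erase c)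
    (π : Equiv.Perm ι) (hπ : ∀ i, c ∈ δ (π i) ↔ c ∉ u i)
    (h₀ : (Matrix.of fun i i' : {i // c ∉ u i} => Θ (u i) ((δ (π i')).erase c)).det ≠ 0)
    (h₁ : (Matrix.of fun i i' : {i // c ∈ u i} => Θ ((u i).erase c) (δ (π i'))).det ≠ 0) :
    (Matrix.of fun i j => Θ (u i) (δ j)).det ≠ 0 := by
  classical
  obtain ⟨f, Θ', hfΘ, hfree, hboth, hzero, hrow⟩ := exists_peel_table Θ hΘ c
  set xc : MvPolynomial (Fin h × Fin h) ℂ := X (c, c) with hxc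
  have hxc0 : xc ≠ 0 := by rw [hxc]; exact X_ne_zero (R := ℂ) (c, c)
  -- the unipotent column operation `E j' j = [c ∈ δ j ∧ δ j' = δ j - c]`
  set E : Matrix ι ι (MvPolynomial (Fin h × Fin h) ℂ) :=
    Matrix.of fun j' j => if c ∈ δ j ∧ δ j' = (δ j).erase c then (1 : MvPolynomial (Fin h × Fin h) ℂ)
      else 0 with hE
  have hEapp : ∀ j' j, E j' j = if c ∈ δ j ∧ δ j' = (δ j).erase c then 1 else 0 := fun _ _ => rfl
  have hEE : E * E = 0 := by
    refine Matrix.ext fun k j => ?_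
    rw [Matrix.mul_apply, Matrix.zero_apply]
    refine Finset.sum_eq_zero fun l _ => ?_
    rw [hEapp, hEapp]
    by_cases h2 : c ∈ δ j ∧ δ l = (δ j).erase c
    · have h3 : ¬ (c ∈ δ l ∧ δ k = (δ l).erase c) := by
        rintro ⟨hcl, -⟩
        rw [h2.2] at hcl
        exact Finset.notMem_erase c (δ j) hcl
      rw [if_neg h3, zero_mul]
    · rw [if_neg h2, mul_zero]
  have hunit : ((1 : Matrix ι ι (MvPolynomial (Fin h × Fin h) ℂ)) + xc • E).det ≠ 0 := by
    have e : ((1 : Matrix ι ι (MvPolynomial (Fin h × Fin h) ℂ)) + xc • E) * (1 - xc • E) = 1 := by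
      have e1 : ((1 : Matrix ι ι (MvPolynomial (Fin h × Fin h) ℂ)) + xc • E) * (1 - xc • E) =
          1 - (xc • E) * (xc • E) := by
        rw [mul_sub, mul_one, add_mul, one_mul]
        abel
      rw [e1, Matrix.smul_mul, Matrix.mul_smul, hEE, smul_zero, smul_zero, sub_zero]
    have e2 := congr_arg Matrix.det e
    rw [Matrix.det_mul, Matrix.det_one] at e2
    exact left_ne_zero_of_mul_eq_one e2
  -- the specialised matrix after the column operation
  set M' : Matrix ι ι (MvPolynomial (Fin h × Fin h) ℂ) := Matrix.of fun i j => Θ' (u i) (δ j) with hM'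
  have hM'app : ∀ i j, M' i j = Θ' (u i) (δ j) := fun _ _ => rfl
  have hcol : ∀ i j, (M' * (1 + xc • E)) i j =
      if c ∈ δ j then (if c ∈ u i then 0 else xc * Θ (u i) ((δ j).erase c))
      else (if c ∈ u i then Θ ((u i).erase c) (δ j) else Θ (u i) (δ j)) := by
    intro i j
    rw [Matrix.mul_add, Matrix.mul_one, Matrix.mul_smul, Matrix.add_apply, Matrix.smul_apply,
      Matrix.mul_apply, hM'app, smul_eq_mul]
    by_cases hcj : c ∈ δ j
    · obtain ⟨j₀, hj₀⟩ := hδcl j hcj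
      have hsum : ∑ l, M' i l * E l j = Θ' (u i) ((δ j).erase c) := by
        rw [Finset.sum_eq_single j₀]
        · rw [hM'app, hEapp, if_pos ⟨hcj, hj₀⟩, mul_one, hj₀]
        · intro l _ hl
          rw [hEapp, if_neg, mul_zero]
          rintro ⟨-, hl'⟩
          exact hl (hδ (hl'.trans hj₀.symm))
        · intro h0
          exact absurd (Finset.mem_univ j₀) h0
      rw [hsum, if_pos hcj]
      by_cases hci : c ∈ u i
      · rw [if_pos hci, hboth _ _ hci hcj, hrow _ _ hci (Finset.notMem_erase c (δ j))]
        ring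
      · rw [if_neg hci, hzero _ _ hci hcj, hfree _ _ hci (Finset.notMem_erase c (δ j)), zero_add]
    · have hsum : ∑ l, M' i l * E l j = 0 := by
        refine Finset.sum_eq_zero fun l _ => ?_
        rw [hEapp, if_neg (fun hh => hcj hh.1), mul_zero]
      rw [hsum, mul_zero, add_zero, if_neg hcj]
      by_cases hci : c ∈ u i
      · rw [if_pos hci, hrow _ _ hci hcj]
      · rw [if_neg hci, hfree _ _ hci hcj]
  set N : Matrix ι ι (MvPolynomial (Fin h × Fin h) ℂ) := (M' * (1 + xc • E)).submatrix id π
    with hN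
  have hNapp : ∀ i i', N i i' = (M' * (1 + xc • E)) i (π i') := fun i i' => by
    rw [hN, Matrix.submatrix_apply, id_eq]
  have hNzero : ∀ i, ¬ (c ∉ u i) → ∀ i', c ∉ u i' → N i i' = 0 := fun i hi i' hi' => by
    rw [hNapp, hcol, if_pos ((hπ i').mpr hi'), if_pos (not_not.mp hi)]
  have hN₁ : N.toSquareBlockProp (fun i => c ∉ u i) = Matrix.of fun i i' : {i // c ∉ u i} =>
      (fun (_ : {i // c ∉ u i}) => xc) i' * Θ (u i) ((δ (π i')).erase c) := by
    ext i i'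
    rw [Matrix.toSquareBlockProp_def, Matrix.of_apply, Matrix.of_apply, hNapp, hcol,
      if_pos ((hπ i').mpr i'.2), if_neg (show ¬ c ∈ u (i : ι) from i.2)]
  have hN₀ : N.toSquareBlockProp (fun i => ¬ (c ∉ u i)) =
      Matrix.of fun i i' : {i // ¬ (c ∉ u i)} => Θ ((u i).erase c) (δ (π i')) := by
    ext i i'
    have hi : c ∈ u (i : ι) := not_not.mp i.2
    have hi' : c ∉ δ (π (i' : ι)) := fun hh => ((hπ i').mp hh) (not_not.mp i'.2)
    rw [Matrix.toSquareBlockProp_def, Matrix.of_apply, Matrix.of_apply, hNapp, hcol, if_neg hi',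
      if_pos hi]
  intro hdet
  have h1 : M'.det = 0 := by
    have e := congr_arg f hdet
    rw [map_zero, RingHom.map_det] at e
    rw [← e]
    congr 1
    ext i j
    rw [RingHom.mapMatrix_apply, Matrix.map_apply, Matrix.of_apply, hM'app, hfΘ]
  have h2 : N.det = 0 := by
    rw [hN, Matrix.det_permute', Matrix.det_mul, h1, zero_mul, mul_zero]
  rw [Matrix.twoBlockTriangular_det N (fun i => c ∉ u i) hNzero, hN₁, hN₀, Matrix.det_mul_row,
    Finset.prod_const] at h2
  rcases mul_eq_zero.mp h2 with h2 | h2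
  · rcases mul_eq_zero.mp h2 with h2 | h2
    · exact hxc0 (pow_eq_zero_iff'.mp h2).1
    · exact h₀ h2
  · -- reindex `{i // ¬ (c ∉ u i)}` as `{i // c ∈ u i}`
    apply h₁
    have e : (Matrix.of fun i i' : {i // c ∈ u i} => Θ ((u i).erase c) (δ (π i'))) =
        (Matrix.of fun i i' : {i // ¬ (c ∉ u i)} => Θ ((u i).erase c) (δ (π i'))).reindex
          (Equiv.subtypeEquivRight fun i => not_not) (Equiv.subtypeEquivRight fun i => not_not) := by
      ext i i'
      rfl
    rw [e, Matrix.det_reindex_self, h2]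

end Summit.ValiantsHypothesis.ValiantsHypothesis.Theorems.BarrierLever.ChowCube
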